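import Summits.NavierStokesRegularity.NavierStokesRegularity.Theorems.TaoForcedUniqueness.Negative.CountableJunkDirections
import Literature.Analysis.FluidPDE.DistributionalToWeakCounterexample

/-!
# K54 (3/4): the junk force `f = U + g_{ℓ(t)}`, the flows `u_ε = ε t U`, energy bookkeeping, and the
# weak formulation

Cell `ns-blowup`, seat `ns-blowup-refuter4` (g0), KILLSHEET §XXV row K54, part 3/4 of the kernel certificate
`¬ Literature.Analysis.FluidPDE.sohr2001_serrinMasuda_uniqueness_forced(_memLp)` (final file
`SohrForcedUniquenessCountableJunk.lean` in this directory, which carries the full account). LABEL: refuter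
construction (explicit data + proved lemmas; no named facts, no `sorry`). WHAT THIS IS NOT: not Navier–Stokes
evidence; nothing here mentions the summit.

Content: `force t x = swirl x + junk (label t) x`, `flow ε t x = (ε t) • swirl x`; `‖f(t)‖₂ ≤ ‖U‖₂ + 1`,
`MemLqLp q 2 force S` and `MemLqLp s p (flow ε) S` for all exponents on sets of finite measure; the work
identity `∫⟪f(τ), u_ε(τ)⟫ = ε τ ‖U‖²` (junk directions are `⊥ U`); Leray's energy inequality from every
`s ≥ 0` when `ε (‖U‖² + 2νT·DU) ≤ ‖U‖²`; and the WEAK IDENTITY `weak_identity_flow` for every space–time test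
field — the integrand is `H(t) + P(ℓ(t), t)` with `H`, `P(a, ·)` measurable, so either it is not
a.e.-strongly measurable (Bochner integral `0` by convention) or the labelling lemma (tree
`ae_eq_of_aestronglyMeasurable_label`) and totality force `ψ(t) = 0` for all `t ∈ (0,T)`.
Hence `isWeakNSSolutionOn_flow`. [folklore]
-/

noncomputable section

namespace Summit.NavierStokesRegularity.ForcedUniquenessCountableJunk

open MeasureTheory Set Filter Topology Function
open scoped ENNReal NNReal RealInnerProductSpace Laplacian
open Literature.Analysis.FluidPDE

/-! ## §6 The force `f = U + g_{ℓ(t)}` and the flows `u_ε = ε t U` -/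

/-- **The force** `f(t, x) = U(x) + g_{ℓ(t)}(x)`. [folklore] -/
def force (t : ℝ) (x : EuclideanSpace ℝ (Fin 3)) : EuclideanSpace ℝ (Fin 3) :=
  swirl x + junk (label t) x

/-- **The flows** `u_ε(t, x) = ε t U(x)`. [folklore] -/
def flow (ε t : ℝ) (x : EuclideanSpace ℝ (Fin 3)) : EuclideanSpace ℝ (Fin 3) := (ε * t) • swirl x

/-- Every slice of the force is in `L²` … [folklore] -/
theorem memLp_force (t : ℝ) : MemLp (force t) 2 volume :=
  (memLp_swirl (p := 2) le_rfl (by simp)).add (memLp_junk (label t))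

/-- … with norm at most `‖U‖₂ + 1`. [folklore] -/
theorem eLpNorm_force_le (t : ℝ) :
    eLpNorm (force t) 2 volume ≤ eLpNorm swirl 2 volume + 1 := by
  refine (eLpNorm_add_le continuous_swirl.aestronglyMeasurable
    (continuous_junk _).aestronglyMeasurable one_le_two).trans ?_
  exact add_le_add le_rfl (eLpNorm_junk_le_one _)

/-- **`f ∈ L^q(S; L²)` for every `q` and every time set of finite measure** (in particular
`f ∈ L¹(0,T'; L²)`), since `‖f(t)‖₂ ≤ ‖U‖₂ + 1`. [folklore] -/
theorem memLqLp_force (q : ℝ≥0∞) {S : Set ℝ} (hS : volume S ≠ ∞) : MemLqLp q 2 force S :=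
  memLqLp_of_ae_eLpNorm_le (C := eLpNorm swirl 2 volume + 1)
    (ENNReal.add_ne_top.2 ⟨(memLp_swirl (p := 2) le_rfl (by simp)).eLpNorm_ne_top, ENNReal.one_ne_top⟩)
    hS (Eventually.of_forall fun t => memLp_force t) (Eventually.of_forall fun t => eLpNorm_force_le t)

/-- The flows are jointly continuous. [folklore] -/
theorem continuous_flow (ε : ℝ) : Continuous (uncurry (flow ε)) :=
  (continuous_const.mul continuous_fst).smul (continuous_swirl.comp continuous_snd)

/-- The slices of the flows are `C¹`. [folklore] -/
theorem contDiff_flow (ε t : ℝ) : ContDiff ℝ 1 (flow ε t) :=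
  swirl_contDiff_one.const_smul (ε * t)

/-- The slices of the flows are in `L^p`, `2 ≤ p < ∞`. [folklore] -/
theorem memLp_flow {p : ℝ≥0∞} (hp : 2 ≤ p) (hp' : p ≠ ∞) (ε t : ℝ) : MemLp (flow ε t) p volume :=
  (memLp_swirl hp hp').const_smul (ε * t)

/-- `‖u_ε(t)‖_p = |ε t| ‖U‖_p`. [folklore] -/
theorem eLpNorm_flow (p : ℝ≥0∞) (ε t : ℝ) :
    eLpNorm (flow ε t) p volume = ‖ε * t‖ₑ * eLpNorm swirl p volume :=
  eLpNorm_const_smul (ε * t) swirl p volume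

/-- **`u_ε ∈ L^q(a, b; L^p)`** for all `q` and `2 ≤ p < ∞` (the Serrin classes). [folklore] -/
theorem memLqLp_flow (q : ℝ≥0∞) {p : ℝ≥0∞} (hp : 2 ≤ p) (hp' : p ≠ ∞) (ε a b : ℝ) :
    MemLqLp q p (flow ε) (Ioo a b) := by
  refine memLqLp_of_ae_eLpNorm_le (C := ‖ε‖ₑ * ENNReal.ofReal (|a| + |b|) * eLpNorm swirl p volume)
    (ENNReal.mul_ne_top (ENNReal.mul_ne_top enorm_ne_top ENNReal.ofReal_ne_top)
      (memLp_swirl hp hp').eLpNorm_ne_top) (by simp [Real.volume_Ioo])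
    (Eventually.of_forall fun t => memLp_flow hp hp' ε t)
    ((ae_restrict_iff' measurableSet_Ioo).2 (Eventually.of_forall fun t ht => ?_))
  rw [eLpNorm_flow, enorm_mul]
  gcongr
  rw [Real.enorm_eq_ofReal_abs]
  exact ENNReal.ofReal_le_ofReal (by
    rcases le_or_gt 0 t with h | h
    · rw [abs_of_nonneg h]; linarith [le_abs_self b, abs_nonneg a, ht.2]
    · rw [abs_of_neg h]; linarith [neg_le_abs a, abs_nonneg b, ht.1])

/-- The derivative of a flow slice. [folklore] -/
theorem fderiv_flow (ε t : ℝ) (x : EuclideanSpace ℝ (Fin 3)) :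
    fderiv ℝ (flow ε t) x = (ε * t) • fderiv ℝ swirl x :=
  (((swirl_contDiff_one.differentiable one_ne_zero) x).hasFDerivAt.const_smul (ε * t)).fderiv

/-- The dissipation `D_U = ∫ |DU|² dx ∈ [0, ∞)` of the profile. [folklore] -/
def DU : ℝ≥0∞ := ∫⁻ x, ENNReal.ofReal (frobeniusNormSq (fderiv ℝ swirl x))

/-- `D_U < ∞`. [folklore] -/
theorem DU_lt_top : DU < ∞ := lintegral_frob_fderiv_swirl_lt_top

/-- The dissipation of a flow slice: `∫ |Du_ε(t)|² = (ε t)² D_U`. [folklore] -/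
theorem lintegral_frob_flow (ε t : ℝ) :
    ∫⁻ x, ENNReal.ofReal (frobeniusNormSq (fderiv ℝ (flow ε t) x)) = ENNReal.ofReal ((ε * t) ^ 2) * DU := by
  simp_rw [fderiv_flow, frobeniusNormSq_smul, ENNReal.ofReal_mul (sq_nonneg _)]
  rw [lintegral_const_mul' _ _ ENNReal.ofReal_ne_top, DU]

/-- The dissipation over `(s, t)`, `0 ≤ s ≤ t`, is at most `(ε t)² D_U (t - s)`. [folklore] -/
theorem dissipation_le (ε : ℝ) {s t : ℝ} (hs : 0 ≤ s) :
    (∫⁻ τ in Ioo s t, ∫⁻ x, ENNReal.ofReal (frobeniusNormSq (fderiv ℝ (flow ε τ) x))) ≤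
      ENNReal.ofReal ((ε * t) ^ 2) * DU * ENNReal.ofReal (t - s) := by
  simp_rw [lintegral_frob_flow]
  calc ∫⁻ τ in Ioo s t, ENNReal.ofReal ((ε * τ) ^ 2) * DU
      ≤ ∫⁻ _τ in Ioo s t, ENNReal.ofReal ((ε * t) ^ 2) * DU := by
        refine setLIntegral_mono measurable_const fun τ hτ => mul_le_mul' (ENNReal.ofReal_le_ofReal ?_) le_rfl
        rw [mul_pow, mul_pow]
        exact mul_le_mul_of_nonneg_left (pow_le_pow_left₀ (hs.trans hτ.1.le) hτ.2.le 2) (sq_nonneg ε)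
    _ = ENNReal.ofReal ((ε * t) ^ 2) * DU * ENNReal.ofReal (t - s) := by
        rw [setLIntegral_const, Real.volume_Ioo]

/-- The kinetic energy of a flow slice: `½‖u_ε(t)‖² = ½ (ε t)² ‖U‖²`. [folklore] -/
theorem kineticEnergy_flow (ε t : ℝ) :
    VectorCalculus.kineticEnergy (flow ε t) = 2⁻¹ * ((ε * t) ^ 2 * normSqU) := by
  unfold VectorCalculus.kineticEnergy normSqU
  congr 1
  rw [← integral_const_mul]
  refine integral_congr_ae (Eventually.of_forall fun x => ?_)
  simp only [flow, norm_smul, mul_pow, Real.norm_eq_abs, sq_abs, real_inner_self_eq_norm_sq]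

/-- The work of the force on a flow slice: `∫ ⟪f(τ), u_ε(τ)⟫ = ε τ ‖U‖²` — the junk direction does no
work (`g_a ⊥ U`). [folklore] -/
theorem integral_inner_force_flow (ε τ : ℝ) :
    ∫ x, ⟪force τ x, flow ε τ x⟫ = ε * normSqU * τ := by
  have hU := memLp_swirl (p := 2) le_rfl (by simp)
  simp only [force, flow, inner_add_left, real_inner_smul_right]
  rw [integral_add ((integrable_inner_of_memLp_two hU hU).const_mul _)
    ((integrable_inner_of_memLp_two (memLp_junk _) hU).const_mul _), integral_const_mul,
    integral_const_mul, integral_inner_junk_swirl, mul_zero, add_zero, normSqU]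
  ring

/-- **The energy inequality** of `u_ε` from any `s ≥ 0`, for `ε (‖U‖² + 2 ν T D_U) ≤ ‖U‖²`:
`½ε²t²‖U‖² + ν ε² ∫ₛᵗ τ² D_U ≤ ½ε²s²‖U‖² + ε‖U‖²(t² - s²)/2`. [folklore] -/
theorem energy_ineq_flow {ν T ε : ℝ} (hν : 0 ≤ ν) (hε : 0 < ε)
    (hεA : ε * (normSqU + 2 * ν * T * DU.toReal) ≤ normSqU) {s t : ℝ} (hs : 0 ≤ s) (hst : s ≤ t)
    (htT : t ≤ T) :
    VectorCalculus.kineticEnergy (flow ε t) +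
        ν * (∫⁻ τ in Ioo s t, ∫⁻ x, ENNReal.ofReal (frobeniusNormSq (fderiv ℝ (flow ε τ) x))).toReal ≤
      VectorCalculus.kineticEnergy (flow ε s) + ∫ τ in s..t, ∫ x, ⟪force τ x, flow ε τ x⟫ := by
  simp_rw [integral_inner_force_flow]
  rw [intervalIntegral.integral_const_mul, integral_id, kineticEnergy_flow, kineticEnergy_flow]
  set A := normSqU with hA
  set D := DU.toReal with hD
  have hD0 : 0 ≤ D := ENNReal.toReal_nonneg
  have hdiss : (∫⁻ τ in Ioo s t, ∫⁻ x, ENNReal.ofReal (frobeniusNormSq (fderiv ℝ (flow ε τ) x))).toReal ≤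
      (ε * t) ^ 2 * D * (t - s) := by
    have h := ENNReal.toReal_mono (ENNReal.mul_ne_top (ENNReal.mul_ne_top ENNReal.ofReal_ne_top
      DU_lt_top.ne) ENNReal.ofReal_ne_top) (dissipation_le ε (t := t) hs)
    rwa [ENNReal.toReal_mul, ENNReal.toReal_mul, ENNReal.toReal_ofReal (sq_nonneg _),
      ENNReal.toReal_ofReal (sub_nonneg.2 hst)] at h
  have hts : t ^ 2 * (t - s) ≤ T * (t + s) * (t - s) :=
    mul_le_mul_of_nonneg_right (by nlinarith) (sub_nonneg.2 hst)
  have c0 : 0 ≤ ν * ε ^ 2 * D := by positivity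
  have h1 : ν * ε ^ 2 * D * (t ^ 2 * (t - s)) ≤ ν * ε ^ 2 * D * (T * (t + s) * (t - s)) :=
    mul_le_mul_of_nonneg_left hts c0
  have hX : 0 ≤ t ^ 2 - s ^ 2 := by nlinarith
  have h3 : 0 ≤ ε * (t ^ 2 - s ^ 2) * (A - ε * (A + 2 * ν * T * D)) :=
    mul_nonneg (mul_nonneg hε.le hX) (sub_nonneg.2 hεA)
  have h4 : ν * (∫⁻ τ in Ioo s t, ∫⁻ x, ENNReal.ofReal (frobeniusNormSq (fderiv ℝ (flow ε τ) x))).toReal ≤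
      ν * ((ε * t) ^ 2 * D * (t - s)) := mul_le_mul_of_nonneg_left hdiss hν
  nlinarith [h1, h3, h4]

/-! ## §7 `u_ε` is a weak solution: the weak form only sees honest test fields, and there are none -/

section WeakForm

variable {T : ℝ} {ψ : ℝ → EuclideanSpace ℝ (Fin 3) → EuclideanSpace ℝ (Fin 3)}

/-- `(u_ε·∇)ψ = ε t (U·∇)ψ`. [folklore] -/
theorem convect_flow (ε t : ℝ) (v : EuclideanSpace ℝ (Fin 3) → EuclideanSpace ℝ (Fin 3))
    (x : EuclideanSpace ℝ (Fin 3)) : convect (flow ε t) v x = (ε * t) • convect swirl v x := by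
  simp only [convect, flow, map_smul]

/-- The honest part of the weak-form integrand is jointly continuous. [folklore] -/
theorem continuous_honest (hψ : IsSpaceTimeTestOn (slab (EuclideanSpace ℝ (Fin 3)) (Iio T) isOpen_Iio) ψ)
    (ν ε : ℝ) :
    Continuous (uncurry fun t x => ⟪flow ε t x, timeDeriv ψ t x⟫ +
      ⟪flow ε t x, convect (flow ε t) (ψ t) x⟫ + ν * ⟪flow ε t x, Δ (ψ t) x⟫ + ⟪swirl x, ψ t x⟫) := by
  have hu : Continuous fun z : ℝ × EuclideanSpace ℝ (Fin 3) => flow ε z.1 z.2 := continuous_flow ε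
  have h1 : Continuous fun z : ℝ × EuclideanSpace ℝ (Fin 3) => timeDeriv ψ z.1 z.2 :=
    hψ.continuous_timeDeriv
  have h2 : Continuous fun z : ℝ × EuclideanSpace ℝ (Fin 3) => convect (flow ε z.1) (ψ z.1) z.2 := by
    simp_rw [convect_flow]
    exact (continuous_const.mul continuous_fst).smul (hψ.continuous_convect_slice swirl_contDiff)
  have h3 : Continuous fun z : ℝ × EuclideanSpace ℝ (Fin 3) => Δ (ψ z.1) z.2 := by
    have h := ((hψ.isSmoothSpaceTimeOn univ).laplacian uniqueDiffOn_univ).continuousOn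
    rw [univ_prod_univ, continuousOn_univ] at h
    exact h
  have h4 : Continuous fun z : ℝ × EuclideanSpace ℝ (Fin 3) => ψ z.1 z.2 := hψ.contDiff.continuous
  exact (((hu.inner h1).add (hu.inner h2)).add (continuous_const.mul (hu.inner h3))).add
    ((continuous_swirl.comp continuous_snd).inner h4)

/-- The honest part of the weak-form integrand is integrable in `x` for each `t` (continuous,
supported in the `x`-shadow of `tsupport ψ`). [folklore] -/
theorem integrable_honest (hψ : IsSpaceTimeTestOn (slab (EuclideanSpace ℝ (Fin 3)) (Iio T) isOpen_Iio) ψ)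
    (ν ε t : ℝ) :
    Integrable (fun x => ⟪flow ε t x, timeDeriv ψ t x⟫ +
      ⟪flow ε t x, convect (flow ε t) (ψ t) x⟫ + ν * ⟪flow ε t x, Δ (ψ t) x⟫ + ⟪swirl x, ψ t x⟫) := by
  obtain ⟨K, hK, hKt⟩ := hψ.exists_compact_slice_subset
  refine ((continuous_honest hψ ν ε).comp (continuous_const.prodMk continuous_id')).integrable_of_hasCompactSupport
    (HasCompactSupport.intro hK fun x hx => ?_)
  have hx' : ∀ s, x ∉ tsupport (ψ s) := fun s h => hx (hKt s h)
  have h0 : ∀ s, ψ s x = 0 := fun s => image_eq_zero_of_notMem_tsupport (hx' s)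
  have h1 := timeDeriv_eq_zero_of_forall h0 t
  simp only [timeDeriv_apply] at h1
  simp [h1, convect, fderiv_of_notMem_tsupport ℝ (hx' t), laplacian_eq_zero_of_notMem_tsupport (hx' t),
    h0 t]

/-- The junk pairing `P(a, t) = ∫ ⟪g_a, ψ(t)⟫` is (strongly) measurable in `t` for each `a`. [folklore] -/
theorem measurable_junkPairing (hψ : IsSpaceTimeTestOn (slab (EuclideanSpace ℝ (Fin 3)) (Iio T) isOpen_Iio) ψ)
    (a : ℕ) : Measurable fun t => ∫ x, ⟪junk a x, ψ t x⟫ := by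
  have hc : Continuous (uncurry fun t x => ⟪junk a x, ψ t x⟫) :=
    ((continuous_junk a).comp continuous_snd).inner hψ.contDiff.continuous
  exact (hc.stronglyMeasurable.integral_prod_right (ν := volume)).measurable

/-- Inside `(0, T) × ℝ³`, if every slice `ψ t`, `t ∈ (0,T)`, vanishes then `(t, x)` is off the
support of `ψ`. [folklore] -/
theorem notMem_tsupport_of_forall_slice_eq_zero (hall : ∀ s ∈ Ioo 0 T, ψ s = 0) {t : ℝ}
    (ht : t ∈ Ioo 0 T) (x : EuclideanSpace ℝ (Fin 3)) : (t, x) ∉ tsupport (uncurry ψ) := by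
  have hsupp : support (uncurry ψ) ⊆ (Ioo 0 T)ᶜ ×ˢ (univ : Set (EuclideanSpace ℝ (Fin 3))) := by
    intro z hz
    refine ⟨fun hz1 => hz ?_, mem_univ _⟩
    show ψ z.1 z.2 = 0
    rw [hall z.1 hz1, Pi.zero_apply]
  have hclosed : IsClosed ((Ioo 0 T)ᶜ ×ˢ (univ : Set (EuclideanSpace ℝ (Fin 3)))) :=
    isOpen_Ioo.isClosed_compl.prod isClosed_univ
  exact fun h => (closure_minimal hsupp hclosed h).1 ht

/-- **The weak identity for `u_ε`.** For a test field `ψ` on `(-∞,T) × ℝ³` the weak-form integral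
`∫₀ᵀ ∫ (⟪u_ε, ∂ₜψ⟫ + ⟪u_ε, (u_ε·∇)ψ⟫ + ν⟪u_ε, Δψ⟫ + ⟪f, ψ⟫) dx dt` vanishes: its integrand is
`H(t) + P(ℓ(t), t)` with `H`, `P(a, ·)` measurable; if it is measurable in `t`, the saturated labelling
forces `P(a,t)` to be independent of `a` for a.e. `t`, i.e. `= P(0,t) = 0`, so `ψ(t) ⊥ g_a` for all `a`,
so `ψ(t) = 0` (totality) for a.e. and then every `t ∈ (0,T)`, and the integrand is zero; if it is not
measurable, the Bochner integral is zero by convention. [folklore] -/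
theorem weak_identity_flow (hψ : IsSpaceTimeTestOn (slab (EuclideanSpace ℝ (Fin 3)) (Iio T) isOpen_Iio) ψ)
    (ν ε : ℝ) :
    (∫ t in Ioo 0 T, ∫ x, (⟪flow ε t x, timeDeriv ψ t x⟫ + ⟪flow ε t x, convect (flow ε t) (ψ t) x⟫ +
        ν * ⟪flow ε t x, Δ (ψ t) x⟫ + ⟪force t x, ψ t x⟫)) +
      ∫ x, ⟪(0 : EuclideanSpace ℝ (Fin 3) → EuclideanSpace ℝ (Fin 3)) x, ψ 0 x⟫ = 0 := by
  -- notation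
  set H : ℝ → ℝ := fun t => ∫ x, (⟪flow ε t x, timeDeriv ψ t x⟫ +
    ⟪flow ε t x, convect (flow ε t) (ψ t) x⟫ + ν * ⟪flow ε t x, Δ (ψ t) x⟫ + ⟪swirl x, ψ t x⟫) with hH
  set P : ℕ → ℝ → ℝ := fun a t => ∫ x, ⟪junk a x, ψ t x⟫ with hP
  set I : ℝ → ℝ := fun t => ∫ x, (⟪flow ε t x, timeDeriv ψ t x⟫ +
    ⟪flow ε t x, convect (flow ε t) (ψ t) x⟫ + ν * ⟪flow ε t x, Δ (ψ t) x⟫ + ⟪force t x, ψ t x⟫) with hI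
  have hdatum : ∫ x, ⟪(0 : EuclideanSpace ℝ (Fin 3) → EuclideanSpace ℝ (Fin 3)) x, ψ 0 x⟫ = 0 := by
    simp
  rw [hdatum, add_zero]
  show ∫ t in Ioo 0 T, I t = 0
  -- the splitting `I = H + P (ℓ t) t`
  have hsplit : ∀ t, I t = H t + P (label t) t := by
    intro t
    simp only [hI, hH, hP]
    rw [← integral_add (integrable_honest hψ ν ε t)
      (integrable_inner_of_memLp_two (memLp_junk _) (hψ.memLp_slice t 2))]
    refine integral_congr_ae (Eventually.of_forall fun x => ?_)
    simp only [force, inner_add_left]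
    ring
  have hHm : Measurable H :=
    ((continuous_honest hψ ν ε).stronglyMeasurable.integral_prod_right (ν := volume)).measurable
  have hPm : ∀ a, Measurable (P a) := fun a => measurable_junkPairing hψ a
  have hP0 : ∀ t, P 0 t = 0 := fun t => by simp [hP, junk]
  by_cases hm : AEStronglyMeasurable I (volume.restrict (Ioo 0 T))
  · -- measurable case: the labelling argument
    have hPl : AEStronglyMeasurable (fun t => P (label t) t) (volume.restrict (Ioo 0 T)) := by
      have h' : (fun t => P (label t) t) = fun t => I t - H t := by
        funext t; rw [hsplit t]; ring
      rw [h']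
      exact hm.sub hHm.aestronglyMeasurable
    have hae : ∀ᵐ t ∂(volume.restrict (Ioo 0 T)), ∀ n, P (label t) t = P n t :=
      ae_all_iff.2 fun n => ForcedUniquenessHygiene.ae_eq_of_aestronglyMeasurable_label
        piece_spec.2.2 label_eq_of_mem hPm measurableSet_Ioo hPl n
    have hzero : ∀ᵐ t ∂(volume.restrict (Ioo 0 T)), ψ t = 0 := by
      filter_upwards [hae] with t ht
      refine eq_zero_of_forall_integral_inner_junk (hψ.contDiff_slice t).continuous
        (hψ.hasCompactSupport_slice t) fun n => ?_
      have h' := ht n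
      rw [ht 0, hP0 t] at h'
      exact h'.symm
    -- every slice in `(0, T)` vanishes: `{t | ψ t ≠ 0} ∩ (0,T)` is open and null
    have hall : ∀ t ∈ Ioo 0 T, ψ t = 0 := by
      have hopen : IsOpen {t : ℝ | ψ t ≠ 0} := by
        have h' : {t : ℝ | ψ t ≠ 0} = ⋃ x, {t | ψ t x ≠ 0} := by
          ext t
          simp only [mem_setOf_eq, mem_iUnion, ne_eq, funext_iff, Pi.zero_apply, not_forall]
        rw [h']
        exact isOpen_iUnion fun x => isOpen_ne_fun
          (hψ.contDiff.continuous.comp (continuous_id.prodMk continuous_const)) continuous_const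
      have hnull : volume ({t : ℝ | ψ t ≠ 0} ∩ Ioo 0 T) = 0 := by
        have h' := ae_iff.1 hzero
        rwa [Measure.restrict_apply' measurableSet_Ioo] at h'
      intro t ht
      by_contra hne
      exact ((hopen.inter isOpen_Ioo).measure_pos volume ⟨t, hne, ht⟩).ne' hnull
    -- hence the integrand vanishes on `(0, T)`
    have hIt : ∀ t ∈ Ioo 0 T, I t = 0 := by
      intro t ht
      refine integral_eq_zero_of_ae (Eventually.of_forall fun x => ?_)
      have hnot := notMem_tsupport_of_forall_slice_eq_zero hall ht x
      have hΔ : Δ (ψ t) x = 0 := by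
        rw [hall t ht]
        show Δ (fun _ : EuclideanSpace ℝ (Fin 3) => (0 : EuclideanSpace ℝ (Fin 3))) x = 0
        rw [InnerProductSpace.laplacian_const]
        rfl
      have h1 := timeDeriv_eq_zero_of_notMem_tsupport hnot
      simp only [timeDeriv_apply] at h1
      simp [h1, convect, fderiv_slice_eq_zero_of_notMem_tsupport hnot,
        apply_eq_zero_of_notMem_tsupport hnot, hΔ]
    rw [setIntegral_congr_fun measurableSet_Ioo hIt]
    simp
  · exact integral_non_aestronglyMeasurable hm

/-- The flows are weakly divergence free. [folklore] -/
theorem isWeaklyDivFree_flow (ε t : ℝ) : IsWeaklyDivFree (flow ε t) := by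
  intro θ hθ
  simp only [flow, real_inner_smul_left, integral_const_mul, swirl_isWeaklyDivFree θ hθ, mul_zero]

/-- **`u_ε` is a weak solution** with force `f` and datum `0`, for every `T`, `ν`, `ε`. [folklore] -/
theorem isWeakNSSolutionOn_flow (T ν ε : ℝ) :
    IsWeakNSSolutionOn T ν force (0 : EuclideanSpace ℝ (Fin 3) → EuclideanSpace ℝ (Fin 3)) (flow ε) := by
  refine ⟨(continuous_flow ε).aestronglyMeasurable, fun K hK => ?_,
    Eventually.of_forall fun t => isWeaklyDivFree_flow ε t, fun ψ hψ _ => weak_identity_flow hψ ν ε⟩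
  -- local square integrability: `|u_ε| ≤ 2|ε| max(|T|,…)` on `(0,T) × K`
  have hb : ∀ z ∈ Ioo 0 T ×ˢ K, ‖uncurry (flow ε) z‖ₑ ^ 2 ≤ ENNReal.ofReal ((|ε| * |T| * 2) ^ 2) := by
    rintro ⟨t, x⟩ ⟨ht, -⟩
    rw [← ofReal_norm, ← ENNReal.ofReal_pow (norm_nonneg _)]
    refine ENNReal.ofReal_le_ofReal (pow_le_pow_left₀ (norm_nonneg _) ?_ 2)
    simp only [uncurry_apply_pair, flow, norm_smul, Real.norm_eq_abs, abs_mul]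
    have ht' : |t| ≤ |T| := by rw [abs_of_pos ht.1]; exact ht.2.le.trans (le_abs_self T)
    have := norm_swirl_le_two x
    gcongr
  refine lt_of_le_of_lt (setLIntegral_mono measurable_const hb) ?_
  rw [setLIntegral_const]
  refine ENNReal.mul_lt_top ENNReal.ofReal_lt_top ?_
  rw [Measure.volume_eq_prod, Measure.prod_prod, Real.volume_Ioo]
  exact ENNReal.mul_lt_top ENNReal.ofReal_lt_top hK.measure_lt_top

end WeakForm

end Summit.NavierStokesRegularity.ForcedUniquenessCountableJunk

end
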